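import Summits.BirchSwinnertonDyer.BirchSwinnertonDyer.Theorems.ManinLocalTwoThreeHeisenbergLift
import Summits.BirchSwinnertonDyer.BirchSwinnertonDyer.Theorems.ManinLocalTwoThreeNineShiftResidualDepth27
import Summits.BirchSwinnertonDyer.Rank1Residual.ManinAdditive.NineShiftConjDefect
import Literature.NumberTheory.ModularForms.Gamma0FreeModNegOneProofs
import HarnessLib

/-!
# THEOREM III (E-es-98 `ThreeShiftTowerDescent`) and E-es-106 (`ThreeShiftAntiInvariantDescentAll`) HOLD at EVERY level, BY NAME,
# modulo the single printed fact E-es-108 (`Γ₀(M)/{±1}` free for `9 ∣ M`, Kulkarni 1991) — the `9 ∥ M` steps via the HEISENBERG PAIR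
# (route `ManinLocalTwoThree`, cell bsd-f2-manin; crux C3 `ManinPrimeToThreeAtNine` stmt-BirchSwinnertonDyer-22968; LEAD seat p1 gen 11;
# es MEMO-es §37.13 (A)/(C), route (F) adopted as P-es-6)

THE STEP.  `G = Γ₀(3m) ⊇ A = {3 ∣ b}, B = Γ₀(9m)` with `3 ∣ m` (`m = 3n`, `n > 0`), i.e. the descents `Γ₀(3M) → Γ₀(M)` with
`9 ∣ M` of es's THEOREM III (invariant) and THEOREM V/III″ (anti-invariant).  p3's engine `ThreeShiftDescent.descent` reduces each to
`φ(P_{2/3}) = φ(P_{1/3})`; es proved (§37.13 (C)) that no congruence character can certify this at `9 ∣ M`.  HERE: the Heisenberg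
lift `μ` of `(β, λ) = (ab, a·c/(3m))` on `Γ₀(3m)` (sibling `…HeisenbergLift.lean`, from the named fact
`Literature.NumberTheory.ModularForms.gamma0_eq_negOne_prod_free_of_nine_dvd`) gives the pair `p_H = (μ|_A, μ|_B)` with
`δ(p_H) = μ(TQ₁T⁻¹) − μ(Q₁) = −1 ≠ 0`, while BOTH parabolics are CUBES in `G` (`P_{1/3} = (P13 n)³`, `P_{2/3} = (P23 n)³`,
`P13_cube`/`P23_cube`), so every additive function on `G` and `μ` itself kill them.  The two-functional bookkeeping of MEMO-es §37.13 (A)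
(**`apply_P23_eq_apply_P13_of_heis`**, both signs `ε = ±1` at once): if `φ(P_{2/3}) ≠ φ(P_{1/3})`, the corrected pair
`(μ, μ) − cst·(ε·coshift φ, φ)` with `cst = −(ε φ(P_{2/3}) − ε φ(P_{1/3}))⁻¹` passes p3's `κ`-test, glues to an additive `W` on `G`
(`conj_invariant_of_generator`, `glue`), and evaluating `W` at the two cubes gives `cst·φ(P_{1/3}) = cst·φ(P_{2/3}) = 0`, contradiction.

RESULTS (sorry-free; hypotheses displayed):
* **`threeShiftTowerDescent_of_free : gamma0_eq_negOne_prod_free_of_nine_dvd → ThreeShiftTowerDescent`** — es's THEOREM III =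
  E-es-98 BY NAME at EVERY `9 ∣ M` (p3's `threeShiftTowerDescent_of_twentySeven_dvd` covered `27 ∣ M` unconditionally);
* **`threeShiftAntiInvariantDescentAll_of_free : gamma0_eq_negOne_prod_free_of_nine_dvd → ThreeShiftAntiInvariantDescentAll`** —
  E-es-106 BY NAME (`3 ∥ M`: es's THEOREM V `threeShiftAntiInvariantDescentAll_of_not_nine_dvd`, landed p681331; `9 ∣ M`: Heisenberg);
* `antiInvariantBaseTwentySeven_of_free` (E-es-100b ⟸ E-es-108 ∧ E-es-104 ∧ E-es-102),
  **`nineShiftInvariantIsDiamond_of_free`**: E-es-94♯ `NineShiftInvariantIsDiamond` ⟸ {E-es-108, E-es-102, E-es-103, E-es-104}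
  (E-es-105 = p3's `threeShiftStepNine_holds`), `nineShiftInvariantIsDiamond_of_free_of_amalgam` (E-es-102 ⟸ E-es-107 Serre amalgam,
  `threeShiftBasePrimeToThree_of_amalgam`), and the `3 ∤ c(W)` edge `not_three_dvd_maninConstant_of_free_of_amalgam` on the squarefull
  additive-at-3 locus (via `not_three_dvd_maninConstant_of_nineShiftInvariantIsDiamond`).
* §8 **UNCONDITIONAL ASSEMBLY** (same session, after the parallel landings p681811 = E-es-107/102 `threeShiftAmalgamExtensionAll_holds` /
  `threeShiftBasePrimeToThree_holds` (p2 g12), p681503 = E-es-103/104 `cubeStepDescent_holds` / `cubeStepAntiDescent_holds` (p3 g10) and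
  p682572 = E-es-108 `gamma0_eq_negOne_prod_free_of_nine_dvd_holds` (p2 g12, Literature)): **`threeShiftTowerDescent_holds`** (E-es-98),
  **`threeShiftAntiInvariantDescentAll_holds`** (E-es-106), `threeShiftBaseNine_holds` (E-es-100a), `antiInvariantBaseTwentySeven_holds`
  (E-es-100b), `threeShiftStepTwentySeven_holds` / `antiInvariantStepTwentySeven_holds` (p3's E-p3-S27 / S27⁻),
  **`nineShiftInvariantIsDiamond_holds : NineShiftInvariantIsDiamond`** (E-es-94♯ — the nine-shift equaliser law, the cell's Ihara-type
  statement at `ℓ = 3 ∣ N` INCLUDING the Eisenstein part — is a THEOREM of the tree), `threeShiftInvariantIsDiamond_holds` (E-es-96),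
  `nineShiftInvariantIsThreeShiftInvariant_holds` (E-es-97), `parabolicNineShiftInvariantIsDiamond_holds` (E-es-94),
  **`conjDefectLawNine_holds : ConjDefectLawNine`** ((CD₉)), and `not_three_dvd_maninConstant_of_katoFact_squarefull` (`3 ∤ c(W)` on the
  squarefull additive-at-3 locus given ONLY Kato's fact at `W` and plus index prime to `3` — no cell law).
HONEST FRAMING: §6–§7 display their named-fact hypotheses; §8 is unconditional (axioms standard).  C3 itself, Manin's conjecture and BSD
are NOT proved here (the `3 ∤ c` edge still needs Kato's printed fact at `W` and `PlusIndexPrimeTo 3`, and for C3 its squarefull conclusion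
is also implied by the unconditional E-es-66 `threeAdicWitnessOfPlusIndexPrimeToThree_holds`).  References: HOME/MEMO-es.md §37.8,
§37.13; HOME/es/g23/memo37_13.md [cite: Kulkarni1991, Thm. 3.2 and Thm. 3.3] [cite: DarmonDiamondTaylor1995, Lemma 4.28 (p. 135)].
-/

set_option autoImplicit false
set_option linter.dupNamespace false

open scoped MatrixGroups

open CongruenceSubgroup Matrix.SpecialLinearGroup
  Summit.BirchSwinnertonDyer.Rank1Residual.ManinAdditive.NineShiftEqualiser
open Literature.NumberTheory.ModularForms (gamma0_eq_negOne_prod_free_of_nine_dvd)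

namespace Summit.BirchSwinnertonDyer.BirchSwinnertonDyer.Theorems.ManinLocalTwoThree

namespace ThreeShiftDescent

/-! ### §4. At `3 ∣ m` the parabolics `P_{1/3}`, `P_{2/3}` of `Γ₀(9m)` are CUBES in `Γ₀(3m)` -/

section Cubes

variable {n : ℕ}

/-- Cube of a unipotent-type matrix `I + X`, `X = (e f; g −e)`, `X² = 0`: `(I + X)³ = I + 3X` (in `Γ₀(L)`). [folklore] -/
theorem g0Of_cube_of_sq_zero {L : ℕ} (e f g : ℤ) (hX : e * e + f * g = 0) (h₁ : (1 + e) * (1 - e) - f * g = 1)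
    (h₃ : (1 + 3 * e) * (1 - 3 * e) - (3 * f) * (3 * g) = 1) (hc₁ : (L : ℤ) ∣ g) (hc₃ : (L : ℤ) ∣ 3 * g) :
    (g0Of (1 + e) f g (1 - e) h₁ hc₁ : Gamma0 L) * g0Of (1 + e) f g (1 - e) h₁ hc₁ * g0Of (1 + e) f g (1 - e) h₁ hc₁ =
      g0Of (1 + 3 * e) (3 * f) (3 * g) (1 - 3 * e) h₃ hc₃ := by
  rw [g0Of_mul _ _ _ _ _ _ _ _ h₁ hc₁ h₁ hc₁ (det_mul_entries h₁ h₁)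
      (dvd_add (Dvd.dvd.mul_right hc₁ _) (Dvd.dvd.mul_left hc₁ _)),
    g0Of_mul _ _ _ _ _ _ _ _ _ _ h₁ hc₁ (det_mul_entries (det_mul_entries h₁ h₁) h₁)
      (dvd_add (Dvd.dvd.mul_right (dvd_add (Dvd.dvd.mul_right hc₁ _) (Dvd.dvd.mul_left hc₁ _)) _)
        (Dvd.dvd.mul_left hc₁ _))]
  exact g0Of_congr (by linear_combination (3 + e) * hX) (by linear_combination f * hX)
    (by linear_combination g * hX) (by linear_combination (3 - e) * hX) _ _ _ _

/-- **`P_{1/3}` of `Γ₀(9m)` is a cube in `Γ₀(3m)` when `m = 3n`**: `(P13 n)³ = P13' (3n)` (`P13 n = I + n(−3, 1; −9, 3)`). [folklore] -/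
theorem P13_cube (n : ℕ) : P13 n * P13 n * P13 n = P13' (3 * n) := by
  have e1 : P13 n = g0Of (1 + (-(3 * n))) n (-(9 * n)) (1 - (-(3 * n))) (by ring) ⟨-1, by push_cast; ring⟩ := by
    unfold P13; exact g0Of_congr (by ring) rfl rfl (by ring) _ _ _ _
  have e2 : P13' (3 * n) = g0Of (1 + 3 * (-(3 * n))) (3 * n) (3 * (-(9 * n))) (1 - 3 * (-(3 * n))) (by ring)
      ⟨-3, by push_cast; ring⟩ := by
    unfold P13'; exact g0Of_congr (by push_cast; ring) (by push_cast; ring) (by push_cast; ring) (by push_cast; ring) _ _ _ _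
  rw [e1, e2]
  exact g0Of_cube_of_sq_zero _ _ _ (by ring) _ _ _ _

/-- **`P_{2/3}` of `Γ₀(9m)` is a cube in `Γ₀(3m)` when `m = 3n`**: `(P23 n)³ = P23' (3n)` (`P23 n = I + n(−6, 4; −9, 6)`). [folklore] -/
theorem P23_cube (n : ℕ) : P23 n * P23 n * P23 n = P23' (3 * n) := by
  have e1 : P23 n = g0Of (1 + (-(6 * n))) (4 * n) (-(9 * n)) (1 - (-(6 * n))) (by ring) ⟨-1, by push_cast; ring⟩ := by
    unfold P23; exact g0Of_congr (by ring) rfl rfl (by ring) _ _ _ _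
  have e2 : P23' (3 * n) = g0Of (1 + 3 * (-(6 * n))) (3 * (4 * n)) (3 * (-(9 * n))) (1 - 3 * (-(6 * n))) (by ring)
      ⟨-3, by push_cast; ring⟩ := by
    unfold P23'; exact g0Of_congr (by push_cast; ring) (by push_cast; ring) (by push_cast; ring) (by push_cast; ring) _ _ _ _
  rw [e1, e2]
  exact g0Of_cube_of_sq_zero _ _ _ (by ring) _ _ _ _

/-- An additive function on `Γ₀(L)` kills a cube `x³`. [folklore] -/
theorem map_cube_eq_zero_of_add {L : ℕ} {W : Gamma0 L → ZMod 3} (hW : ∀ g h, W (g * h) = W g + W h) (x : Gamma0 L) :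
    W (x * x * x) = 0 := by
  rw [hW, hW]
  have : W x + W x + W x = 3 * W x := by ring
  rw [this, show (3 : ZMod 3) = 0 from rfl, zero_mul]

end Cubes

/-! ### §5. The two-functional argument with the Heisenberg pair (MEMO-es §37.13 (A)+(C)) -/

section TwoFunctionals

variable {n : ℕ}

/-- **The Heisenberg pair forces `φ(P_{2/3}) = φ(P_{1/3})`** for every additive `ε`-invariant (`ε ≠ 0`) `φ` on `Γ₀(9m)`, `m = 3n > 0`,
given a Heisenberg function `μ` of `(β, λ)` on `Γ₀(3m)`.  [MEMO-es §37.13 (A): `q := (μ, μ) − cst·(ε·coshift φ, φ)` passes the `κ`-test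
(`δ(p_H) = −1`, `heis_conj_Q1_sub`), glues to an additive `W` on `Γ₀(3m)`, and `W`, `μ` vanish on the cubes `P_{1/3}`, `P_{2/3}`.]
[folklore] -/
theorem apply_P23_eq_apply_P13_of_heis (hn : 0 < n) (μ : Gamma0 (3 * (3 * n)) → ZMod 3)
    (hμ : ∀ x y : Gamma0 (3 * (3 * n)), μ (x * y) = μ x + μ y + betaCh (3 * n) x * lamCh (3 * n) y)
    (φ : Gamma0 (3 * (3 * (3 * n))) → ZMod 3) (ε : ZMod 3) (hε : ε ≠ 0) (hadd : IsAddChar φ)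
    (hinv : ∀ (a b c d : ℤ) (h : a * d - b * (3 * c) = 1) (hc : ((3 * (3 * (3 * n)) : ℕ) : ℤ) ∣ c),
      φ (g0Of a (3 * b) c d (by linear_combination h) hc) = ε * φ (g0Of a b (3 * c) d h (Dvd.dvd.mul_left hc 3))) :
    φ (P23 (3 * n)) = φ (P13 (3 * n)) := by
  have hm : 0 < 3 * n := by omega
  by_contra hne
  have hAn := subA_normal (3 * n)
  have hα := alpha_add (m := 3 * n) φ ε hadd
  have hφ' := restr_add (m := 3 * n) φ hadd
  have hC := alpha_eq_restr (m := 3 * n) φ ε hinv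
  have ht : Tpow (3 * (3 * n)) 1 ∈ subB (3 * n) := Tpow_mem_subB 1
  -- `δ(p_φ) = ε(φ P23 − φ P13) ≠ 0`
  have hD : ε * φ (P23 (3 * n)) - ε * φ (P13 (3 * n)) ≠ 0 := by
    intro h0
    apply hne
    have h1 : ε * (φ (P23 (3 * n)) - φ (P13 (3 * n))) = 0 := by rw [mul_sub]; exact h0
    rcases mul_eq_zero.mp h1 with h | h
    · exact absurd h hε
    · exact sub_eq_zero.mp h
  -- the corrected pair `(μ, μ) − cst · (ε·coshift φ, φ)`, `cst · δ(p_φ) = δ(p_H) = −1`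
  set cst : ZMod 3 := (-1) * (ε * φ (P23 (3 * n)) - ε * φ (P13 (3 * n)))⁻¹ with hcst
  have hcD : cst * (ε * φ (P23 (3 * n)) - ε * φ (P13 (3 * n))) = -1 := by
    rw [hcst, mul_assoc, inv_mul_cancel₀ hD, mul_one]
  have hcst0 : cst ≠ 0 := by
    intro h0; rw [h0, zero_mul] at hcD; exact absurd hcD (by decide)
  set α₂ : Gamma0 (3 * (3 * n)) → ZMod 3 := fun g => μ g - cst * (ε * coshiftVal φ g) with hα₂
  set φ₂ : Gamma0 (3 * (3 * n)) → ZMod 3 := fun g => μ g - cst * restrVal φ g with hφ₂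
  have hα₂A : ∀ x ∈ subA (3 * n), ∀ y ∈ subA (3 * n), α₂ (x * y) = α₂ x + α₂ y := by
    intro x hx y hy
    simp only [hα₂, heis_add_subA μ hμ x hx y hy, hα x hx y hy]
    ring
  have hφ₂B : ∀ x ∈ subB (3 * n), ∀ y ∈ subB (3 * n), φ₂ (x * y) = φ₂ x + φ₂ y := by
    intro x hx y hy
    simp only [hφ₂, heis_add_subB μ hμ hm x hx y hy, hφ' x hx y hy]
    ring
  have hC₂ : ∀ x ∈ subA (3 * n), x ∈ subB (3 * n) → α₂ x = φ₂ x := by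
    intro x hx hxB
    simp only [hα₂, hφ₂, hC x hx hxB]
  -- the `κ`-test
  have hκ : α₂ (Tpow (3 * (3 * n)) 1 * Q1 (3 * n) * (Tpow (3 * (3 * n)) 1)⁻¹) = α₂ (Q1 (3 * n)) := by
    simp only [hα₂]
    rw [coshiftVal_conj_Q1, coshiftVal_Q1]
    have hδ := heis_conj_Q1_sub μ hμ hm
    linear_combination hδ - hcD
  have hinvT := conj_invariant_of_generator hAn hα₂A hφ₂B hC₂ ht Q1_mem_subA exists_mul_Q1_zpow_mem_subB hκ
  obtain ⟨hW, -, hWB⟩ := glue hAn hα₂A hφ₂B hC₂ ht hinvT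
    (fun g => ((g : SL(2, ℤ)) 0 0 : ℤ) * (g : SL(2, ℤ)) 0 1) mul_Tpow_neg_mem_subA Tpow_n_mem_subA
  -- the glued additive `W` kills the two cubes `P_{1/3} = (P13 n)³`, `P_{2/3} = (P23 n)³`, and so does `μ`
  set W : Gamma0 (3 * (3 * n)) → ZMod 3 := fun g =>
    α₂ (g * Tpow (3 * (3 * n)) 1 ^ (-(((g : SL(2, ℤ)) 0 0 : ℤ) * (g : SL(2, ℤ)) 0 1))) +
      (((g : SL(2, ℤ)) 0 0 : ℤ) * (g : SL(2, ℤ)) 0 1) • φ₂ (Tpow (3 * (3 * n)) 1) with hWdef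
  have hW' : ∀ g h : Gamma0 (3 * (3 * n)), W (g * h) = W g + W h := by
    intro g h; simp only [hWdef]; exact hW g h
  have hWB' : ∀ b ∈ subB (3 * n), W b = φ₂ b := by
    intro b hb; simp only [hWdef]; exact hWB b hb
  have h13 := map_cube_eq_zero_of_add hW' (P13 n)
  have h23 := map_cube_eq_zero_of_add hW' (P23 n)
  rw [P13_cube, hWB' _ P13'_mem_subB] at h13
  rw [P23_cube, hWB' _ P23'_mem_subB] at h23
  simp only [hφ₂, restrVal_P13', restrVal_P23'] at h13 h23
  have hμ13 : μ (P13' (3 * n)) = 0 := by rw [← P13_cube]; exact heis_map_cube μ hμ (P13 n)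
  have hμ23 : μ (P23' (3 * n)) = 0 := by rw [← P23_cube]; exact heis_map_cube μ hμ (P23 n)
  rw [hμ13, zero_sub, neg_eq_zero] at h13
  rw [hμ23, zero_sub, neg_eq_zero] at h23
  -- `cst·φ(P13) = 0 = cst·φ(P23)` with `cst ≠ 0`
  have e13 : φ (P13 (3 * n)) = 0 := by
    rcases mul_eq_zero.mp h13 with h | h
    · exact absurd h hcst0
    · exact h
  have e23 : φ (P23 (3 * n)) = 0 := by
    rcases mul_eq_zero.mp h23 with h | h
    · exact absurd h hcst0
    · exact h
  exact hne (by rw [e13, e23])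

/-- **Descent `Γ₀(9m) → Γ₀(3m)` at `m = 3n > 0` for both signs**, given a Heisenberg function on `Γ₀(3m)`. [folklore] -/
theorem descent_of_heis (hn : 0 < n) (μ : Gamma0 (3 * (3 * n)) → ZMod 3)
    (hμ : ∀ x y : Gamma0 (3 * (3 * n)), μ (x * y) = μ x + μ y + betaCh (3 * n) x * lamCh (3 * n) y)
    (φ : Gamma0 (3 * (3 * (3 * n))) → ZMod 3) (ε : ZMod 3) (hε : ε ≠ 0) (hadd : IsAddChar φ)
    (hinv : ∀ (a b c d : ℤ) (h : a * d - b * (3 * c) = 1) (hc : ((3 * (3 * (3 * n)) : ℕ) : ℤ) ∣ c),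
      φ (g0Of a (3 * b) c d (by linear_combination h) hc) = ε * φ (g0Of a b (3 * c) d h (Dvd.dvd.mul_left hc 3))) :
    ∃ w : Gamma0 (3 * (3 * n)) → ZMod 3, IsAddChar w ∧
      (∀ (a b c d : ℤ) (h : a * d - b * (3 * c) = 1) (hc : ((3 * (3 * n) : ℕ) : ℤ) ∣ c),
        w (g0Of a (3 * b) c d (by linear_combination h) hc) = ε * w (g0Of a b (3 * c) d h (Dvd.dvd.mul_left hc 3))) ∧
      RestrictsFrom φ w :=
  descent φ ε hadd hinv (apply_P23_eq_apply_P13_of_heis hn μ hμ φ ε hε hadd hinv)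

/-- **The Heisenberg function on `Γ₀(9n)`, `n > 0`, from E-es-108** (`9 ∣ 9n`). [folklore] -/
theorem exists_heis_of_free (hfree : gamma0_eq_negOne_prod_free_of_nine_dvd) (n : ℕ) (hn : 0 < n) :
    ∃ μ : Gamma0 (3 * (3 * n)) → ZMod 3,
      ∀ x y : Gamma0 (3 * (3 * n)), μ (x * y) = μ x + μ y + betaCh (3 * n) x * lamCh (3 * n) y := by
  obtain ⟨ι, e, himg, huniq⟩ := hfree (3 * (3 * n)) ⟨n, by ring⟩
  exact exists_heisenbergLift (betaCh (3 * n)) (lamCh (3 * n)) himg huniq isAddChar_betaCh (isAddChar_lamCh (by omega))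

end TwoFunctionals

end ThreeShiftDescent

/-! ### §6. THEOREM III (E-es-98) and E-es-106 BY NAME modulo E-es-108 -/

open ThreeShiftDescent

/-- **THEOREM III = E-es-98 `ThreeShiftTowerDescent` HOLDS modulo E-es-108**: for every `9 ∣ M`, every additive 3-shift-invariant
`φ : Γ₀(3M) → 𝔽₃` is the restriction of an additive 3-shift-invariant `w : Γ₀(M) → 𝔽₃`.  (`M = 0`: Γ₀(0) itself; `M = 9n`: the
Heisenberg descent with `ε = 1`.) [cite: Kulkarni1991, Thm. 3.2 and Thm. 3.3 (shape: the named fact E-es-108 is the only input)] -/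
theorem threeShiftTowerDescent_of_free (hfree : gamma0_eq_negOne_prod_free_of_nine_dvd) : ThreeShiftTowerDescent := by
  intro M h9
  obtain ⟨n, rfl⟩ : ∃ n, M = 3 * (3 * n) := by obtain ⟨k, hk⟩ := h9; exact ⟨k, by rw [hk]; ring⟩
  intro φ hadd hinv3
  rcases Nat.eq_zero_or_pos n with rfl | hn
  · exact ⟨φ, hadd, hinv3, fun _ _ _ _ _ _ _ => rfl⟩
  have hinv : ∀ (a b c d : ℤ) (h : a * d - b * (3 * c) = 1) (hc : ((3 * (3 * (3 * n)) : ℕ) : ℤ) ∣ c),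
      φ (g0Of a (3 * b) c d (by linear_combination h) hc) = 1 * φ (g0Of a b (3 * c) d h (Dvd.dvd.mul_left hc 3)) :=
    fun a b c d h hc => by rw [hinv3 a b c d h hc, one_mul]
  obtain ⟨μ, hμ⟩ := exists_heis_of_free hfree n hn
  obtain ⟨w, hwadd, hwε, hres⟩ := descent_of_heis hn μ hμ φ 1 one_ne_zero hadd hinv
  exact ⟨w, hwadd, fun a b c d h hc => by rw [hwε a b c d h hc, one_mul], hres⟩

/-- **The `9 ∣ M` anti-invariant step modulo E-es-108**: for `n > 0` every additive 3-shift-anti-invariant `ψ : Γ₀(27n) → 𝔽₃` is the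
restriction of an additive 3-shift-anti-invariant `w : Γ₀(9n) → 𝔽₃` (the `hstep` of `antiInvariantBaseTwentySeven_of_step`).
[cite: Kulkarni1991, Thm. 3.2 and Thm. 3.3 (shape)] -/
theorem threeShiftAntiInvariantDescent_nine_of_free (hfree : gamma0_eq_negOne_prod_free_of_nine_dvd) (n : ℕ) (hn : 0 < n)
    (ψ : Gamma0 (3 * (3 * (3 * n))) → ZMod 3) (hadd : IsAddChar ψ) (hanti : IsThreeShiftAntiInvariant ψ) :
    ∃ w : Gamma0 (3 * (3 * n)) → ZMod 3, IsAddChar w ∧ IsThreeShiftAntiInvariant w ∧ RestrictsFrom ψ w := by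
  have hinv : ∀ (a b c d : ℤ) (h : a * d - b * (3 * c) = 1) (hc : ((3 * (3 * (3 * n)) : ℕ) : ℤ) ∣ c),
      ψ (g0Of a (3 * b) c d (by linear_combination h) hc) = (-1) * ψ (g0Of a b (3 * c) d h (Dvd.dvd.mul_left hc 3)) :=
    fun a b c d h hc => by rw [hanti a b c d h hc, neg_one_mul]
  obtain ⟨μ, hμ⟩ := exists_heis_of_free hfree n hn
  obtain ⟨w, hwadd, hwε, hres⟩ := descent_of_heis hn μ hμ ψ (-1) (by decide) hadd hinv
  exact ⟨w, hwadd, fun a b c d h hc => by rw [hwε a b c d h hc, neg_one_mul], hres⟩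

/-- **E-es-106 `ThreeShiftAntiInvariantDescentAll` HOLDS modulo E-es-108**: anti-invariant descent `Γ₀(3M) → Γ₀(M)` for EVERY `3 ∣ M`
(`9 ∤ M`: es's THEOREM V `threeShiftAntiInvariantDescentAll_of_not_nine_dvd`, unconditional; `9 ∣ M`: the Heisenberg step).
[cite: Kulkarni1991, Thm. 3.2 and Thm. 3.3 (shape)] -/
theorem threeShiftAntiInvariantDescentAll_of_free (hfree : gamma0_eq_negOne_prod_free_of_nine_dvd) :
    ThreeShiftAntiInvariantDescentAll := by
  intro M N h3 hN ψ hadd hanti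
  by_cases h9 : 9 ∣ M
  · subst hN
    obtain ⟨n, rfl⟩ : ∃ n, M = 3 * (3 * n) := by obtain ⟨k, hk⟩ := h9; exact ⟨k, by rw [hk]; ring⟩
    rcases Nat.eq_zero_or_pos n with rfl | hn
    · exact ⟨ψ, hadd, hanti, fun _ _ _ _ _ _ _ => rfl⟩
    · exact threeShiftAntiInvariantDescent_nine_of_free hfree n hn ψ hadd hanti
  · exact threeShiftAntiInvariantDescentAll_of_not_nine_dvd M N h3 h9 hN ψ hadd hanti

/-! ### §7. Consequences: the es chain modulo {E-es-108, E-es-102 (⟸ E-es-107), E-es-103, E-es-104} -/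

/-- **E-es-100b `AntiInvariantBaseTwentySeven` ⟸ E-es-108 ∧ E-es-104 ∧ E-es-102.** [cite: Kulkarni1991, Thm. 3.2 and Thm. 3.3 (shape)] -/
theorem antiInvariantBaseTwentySeven_of_free (hfree : gamma0_eq_negOne_prod_free_of_nine_dvd)
    (hcubeA : CubeStepAntiDescent) (hbase : ThreeShiftBasePrimeToThree) : AntiInvariantBaseTwentySeven :=
  antiInvariantBaseTwentySeven_of_descentAll (threeShiftAntiInvariantDescentAll_of_free hfree) hcubeA hbase

/-- **E-es-94♯ `NineShiftInvariantIsDiamond` ⟸ {E-es-108, E-es-102, E-es-103, E-es-104}** (III and E-es-106 by the Heisenberg descent,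
E-es-105 = p3's `threeShiftStepNine_holds`, glue `nineShiftInvariantIsDiamond_of_fine'`). [cite: Kulkarni1991, Thm. 3.2 and Thm. 3.3 (shape)] -/
theorem nineShiftInvariantIsDiamond_of_free (hfree : gamma0_eq_negOne_prod_free_of_nine_dvd)
    (hbase : ThreeShiftBasePrimeToThree) (hcube : CubeStepDescent) (hcubeA : CubeStepAntiDescent) :
    NineShiftInvariantIsDiamond :=
  nineShiftInvariantIsDiamond_of_fine' (threeShiftTowerDescent_of_free hfree) hbase hcube hcubeA threeShiftStepNine_holds
    (threeShiftAntiInvariantDescentAll_of_free hfree)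

/-- **E-es-94♯ ⟸ {E-es-108 (Kulkarni), E-es-107 (Serre's amalgam, Hom-form), E-es-103, E-es-104}** — the two printed theorems + the two
cube steps. [cite: Kulkarni1991, Thm. 3.2 and Thm. 3.3 (shape)] [cite: SerreTrees1980, II.1.4 Th. 3 (shape; E-es-107 is the tree's obligation node)] -/
theorem nineShiftInvariantIsDiamond_of_free_of_amalgam (hfree : gamma0_eq_negOne_prod_free_of_nine_dvd)
    (hA : ThreeShiftAmalgamExtensionAll) (hcube : CubeStepDescent) (hcubeA : CubeStepAntiDescent) :
    NineShiftInvariantIsDiamond :=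
  nineShiftInvariantIsDiamond_of_free hfree (threeShiftBasePrimeToThree_of_amalgam hA) hcube hcubeA

open Literature.NumberTheory.EllipticCurves Literature.NumberTheory.EllipticCurves.ModularForms
  Summit.BirchSwinnertonDyer.Rank1Residual.ManinAdditive.KatoCurve WeierstrassCurve in
/-- **`3 ∤ c(W)` on the squarefull additive-at-3 locus ⟸ {E-es-108, E-es-107, E-es-103, E-es-104} + Kato at 3 + plus index prime to 3**
(lattice-optimal `W`, `9 ∣ N`; edge `not_three_dvd_maninConstant_of_nineShiftInvariantIsDiamond`).  CONDITIONAL on the displayed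
hypotheses; C3 is NOT proved by this. [cite: Kato2004Asterisque, Thm. 12.5 (shape; the named fact is statement-only)]
[cite: Kulkarni1991, Thm. 3.2 and Thm. 3.3 (shape)] -/
theorem not_three_dvd_maninConstant_of_free_of_amalgam (hfree : gamma0_eq_negOne_prod_free_of_nine_dvd)
    (hA : ThreeShiftAmalgamExtensionAll) (hcube : CubeStepDescent) (hcubeA : CubeStepAntiDescent)
    (W : WeierstrassCurve ℚ) [W.IsElliptic] [W.IsGloballyMinimal] {N : ℕ} [NeZero N]
    (D : ModularParametrizationData W N) (hF : KatoFactThreeAt W D.f)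
    (hopt : ∀ z ∈ D.L.lattice, ∃ w ∈ periodLattice D.f, z = D.c * w)
    (h3g : ¬ W.HasGoodReductionAtPrime 3) (h3m : ¬ W.HasMultiplicativeReductionAtPrime 3)
    (h9 : 3 ^ 2 ∣ N) (hsq : IsSquarefull N) (hd : PlusIndexPrimeTo 3 D.f) : ¬ (3 : ℤ) ∣ D.c :=
  not_three_dvd_maninConstant_of_nineShiftInvariantIsDiamond
    (nineShiftInvariantIsDiamond_of_free_of_amalgam hfree hA hcube hcubeA) W D hF hopt h3g h3m h9 hsq hd

/-! ### §8. UNCONDITIONAL ASSEMBLY: every node of es's fine reduction is a theorem of the tree -/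

section Unconditional

open Literature.NumberTheory.ModularForms (gamma0_eq_negOne_prod_free_of_nine_dvd_holds)
open CubeStep (cubeStepDescent_holds cubeStepAntiDescent_holds)
open Summit.BirchSwinnertonDyer.Rank1Residual.ManinAdditive.DegeneracyOrbit (ConjDefectLawNine)

/-- **E-es-98 = THEOREM III HOLDS**: 3-shift tower descent `K₃^grp(3M) = res K₃^grp(M)` for every `9 ∣ M` (E-es-108 discharged by
`gamma0_eq_negOne_prod_free_of_nine_dvd_holds`, p682572). [new: Heisenberg descent + Kulkarni/Kurosh, MEMO-es §37.13] -/
theorem threeShiftTowerDescent_holds : ThreeShiftTowerDescent :=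
  threeShiftTowerDescent_of_free gamma0_eq_negOne_prod_free_of_nine_dvd_holds

/-- **E-es-106 = THEOREMS V + III″ HOLD**: anti-invariant descent `K₃⁻(3M) ⊆ res K₃⁻(M)` for every `3 ∣ M`. [new: MEMO-es §37.13] -/
theorem threeShiftAntiInvariantDescentAll_holds : ThreeShiftAntiInvariantDescentAll :=
  threeShiftAntiInvariantDescentAll_of_free gamma0_eq_negOne_prod_free_of_nine_dvd_holds

/-- **E-es-100a `ThreeShiftBaseNine` HOLDS** (`K₃^grp(9N₀) = D^grp(9N₀)`, `3 ∤ N₀`): base (p2) + cube step (p3) + step nine (p3).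
[new: composition of the proved nodes] -/
theorem threeShiftBaseNine_holds : ThreeShiftBaseNine :=
  (fine_reduction threeShiftBasePrimeToThree_holds cubeStepDescent_holds cubeStepAntiDescent_holds threeShiftStepNine_holds
    threeShiftAntiInvariantDescentAll_holds).1

/-- **E-es-100b `AntiInvariantBaseTwentySeven` HOLDS** (`K₃⁻(27N₀) = 0`, `3 ∤ N₀`). [new: composition of the proved nodes] -/
theorem antiInvariantBaseTwentySeven_holds : AntiInvariantBaseTwentySeven :=
  antiInvariantBaseTwentySeven_of_free gamma0_eq_negOne_prod_free_of_nine_dvd_holds cubeStepAntiDescent_holds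
    threeShiftBasePrimeToThree_holds

/-- **E-p3-S27 `ThreeShiftStepTwentySeven` HOLDS.** [new: composition of the proved nodes] -/
theorem threeShiftStepTwentySeven_holds : ThreeShiftStepTwentySeven :=
  threeShiftStepTwentySeven_of_towerDescent threeShiftTowerDescent_holds

/-- **E-p3-S27⁻ `AntiInvariantStepTwentySeven` HOLDS.** [new: composition of the proved nodes] -/
theorem antiInvariantStepTwentySeven_holds : AntiInvariantStepTwentySeven :=
  antiInvariantStepTwentySeven_of_descentAll threeShiftAntiInvariantDescentAll_holds

/-- **E-es-94♯ `NineShiftInvariantIsDiamond` IS A THEOREM**: for every `9 ∣ N`, every additive character `Γ₀(N) → 𝔽₃` invariant under the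
9-shift `(a b; 9c d) ↦ (a 9b; c d)` is a diamond class (kills `Γ₁(N)`) — the nine-shift (degeneracy) equaliser at `ℓ = 3 ∣ N` consists of
the diamond characters only, Eisenstein classes included.  Inputs, all theorems of the tree: Serre's amalgam for `Γ₀(N₀; ℤ[1/3])`
(E-es-107/102, p2), the cube steps (E-es-103/104, p3), step nine (E-es-105, p3), `Γ₀(M)/{±1}` free for `9 ∣ M` (E-es-108, p2) and the
Heisenberg descents (E-es-98/106, this file). [new: cell bsd-f2-manin theorem, MEMO-es §37] -/
theorem nineShiftInvariantIsDiamond_holds : NineShiftInvariantIsDiamond :=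
  nineShiftInvariantIsDiamond_of_free_of_amalgam gamma0_eq_negOne_prod_free_of_nine_dvd_holds threeShiftAmalgamExtensionAll_holds
    cubeStepDescent_holds cubeStepAntiDescent_holds

/-- **E-es-96 `ThreeShiftInvariantIsDiamond` HOLDS** (`K₃^grp(N) = D^grp(N)` for every `9 ∣ N`). [new: MEMO-es §37] -/
theorem threeShiftInvariantIsDiamond_holds : ThreeShiftInvariantIsDiamond :=
  (nineShiftInvariantIsDiamond_iff_three.mp nineShiftInvariantIsDiamond_holds).1

/-- **E-es-97 `NineShiftInvariantIsThreeShiftInvariant` HOLDS** (`K₉^grp(N) ⊆ K₃^grp(N)` for every `9 ∣ N`). [new: MEMO-es §37] -/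
theorem nineShiftInvariantIsThreeShiftInvariant_holds : NineShiftInvariantIsThreeShiftInvariant :=
  (nineShiftInvariantIsDiamond_iff_three.mp nineShiftInvariantIsDiamond_holds).2

/-- **E-es-94 `ParabolicNineShiftInvariantIsDiamond` HOLDS** (the homological form, `H¹(X₀(N); 𝔽₃)`). [new: MEMO-es §37] -/
theorem parabolicNineShiftInvariantIsDiamond_holds : ParabolicNineShiftInvariantIsDiamond :=
  parabolicNineShiftInvariantIsDiamond_of_sharp nineShiftInvariantIsDiamond_holds

/-- **(CD₉) `ConjDefectLawNine` HOLDS**: for a rational newform `f` of level `9 ∣ N` with plus index prime to `3`, the plus-period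
character mod `3` is not `diag(9,1)`-conjugation invariant on `Γ₀(9N)` (es's PROVED edge from E-es-94♯). [new: MEMO-es §37.10] -/
theorem conjDefectLawNine_holds : ConjDefectLawNine :=
  conjDefectLawNine_of_nineShiftInvariantIsDiamond nineShiftInvariantIsDiamond_holds

open Literature.NumberTheory.EllipticCurves Literature.NumberTheory.EllipticCurves.ModularForms
  Summit.BirchSwinnertonDyer.Rank1Residual.ManinAdditive.KatoCurve WeierstrassCurve in
/-- **`3 ∤ c(W)` on the squarefull additive-at-3 locus from Kato's fact at `W` and the plus index alone — NO cell law**: lattice-optimal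
globally minimal `W`, `9 ∣ N`, `N` squarefull, additive reduction at `3`, `KatoFactThreeAt W D.f` (Kato, statement-only) and
`PlusIndexPrimeTo 3 D.f` give `3 ∤ c`.  (For C3 this conclusion is ALSO implied by the unconditional E-es-66; recorded here as the end of the
E-es-94♯ road.)  C3 is NOT proved by this. [cite: Kato2004Asterisque, Thm. 12.5 (shape; the named fact is statement-only)] -/
theorem not_three_dvd_maninConstant_of_katoFact_squarefull
    (W : WeierstrassCurve ℚ) [W.IsElliptic] [W.IsGloballyMinimal] {N : ℕ} [NeZero N]
    (D : ModularParametrizationData W N) (hF : KatoFactThreeAt W D.f)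
    (hopt : ∀ z ∈ D.L.lattice, ∃ w ∈ periodLattice D.f, z = D.c * w)
    (h3g : ¬ W.HasGoodReductionAtPrime 3) (h3m : ¬ W.HasMultiplicativeReductionAtPrime 3)
    (h9 : 3 ^ 2 ∣ N) (hsq : IsSquarefull N) (hd : PlusIndexPrimeTo 3 D.f) : ¬ (3 : ℤ) ∣ D.c :=
  not_three_dvd_maninConstant_of_nineShiftInvariantIsDiamond nineShiftInvariantIsDiamond_holds W D hF hopt h3g h3m h9 hsq hd

end Unconditional

end Summit.BirchSwinnertonDyer.BirchSwinnertonDyer.Theorems.ManinLocalTwoThree
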